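import Summits.BirchSwinnertonDyer.BirchSwinnertonDyer.Theorems.SignedLowerHalvesKobayashiMainConjectureSmallImageSignedMuOneSign
import HarnessLib

/-!
# Route `SignedLowerHalves`, crux `KobayashiMainConjectureSmallImage` (item stmt-BirchSwinnertonDyer-19002):
# the EULER-SYSTEM `μ`-TRANSFER at NON-SURJECTIVE image, part 6 — the SIGNED `μ`/`λ`-DEFECT IDENTITY
# «`length_𝔭 X^ε + length_𝔭 (𝐇¹/Z) = length_𝔭 X₀ + length_𝔭 Λ/(L_p^ε)`» at every height-one prime
# (cell `bsd-ssimc`, WIDTH-LEVER lane B = seat `bsd-ssimc-k3-c4x` g2; helper file,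
# `--supports stmt-BirchSwinnertonDyer-19002 --as helper`; theorems only; route-independent imports)

HONEST FRAMING.  Kobayashi's signed main conjecture at a non-surjective image is OPEN and stays so;
nothing here is booked; BSD is not proved by any of this.  Everything below is kernel-checked module
theory over part 2's construction fact (`Kobayashi2003.thm62_63_73_signedColemanKato_zeta`, p529649,
reviewed) plus, in §3 only, the displayed binders of parts 3/4.

PARTITION (cell bsd-ssimc): X7 (A7) × item 4's ENTIRE domain (any image, in fact) — types-the-object-of; closes NONE.

## The identity

Kato, Astérisque 295 (2004), §17.13, p. 280 (ordinary setting, quoted in the tree's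
`Kato2004/DivisibilityInputsMu.lean`): "Hence we obtain an exact sequence
`0 → 𝐇¹(T)_𝔭/Z(f,T)_𝔭 → Λ_𝔭/(L) → 𝔛_𝔭 → 𝐇²(T)_𝔭 → 0`.  Hence …
`length(𝔛_𝔭) − length(Λ_𝔭/(L)) = length(𝐇²_𝔭) − length(𝐇¹_𝔭/Z(f,T)_𝔭)`."  Kobayashi, Invent.
Math. 152 (2003), proof of Thm. 7.4 (p. 13), supersingular `p`, `a_p = 0`: "By Theorem 6.2, 6.3 and
(7.21), we have … `0 → 𝐇¹(T)^Δ/Z(T)^Δ → Λ^Δ/(L_p^±(E, X)) → X^±(E/K_∞)^Δ → X⁰(E/K_∞)^Δ → 0`"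
(and `𝐇²(T) ≅ X⁰(E/K_∞)`, Prop. 7.1 ii)).  This file proves the signed length identity ON THE PINNED
OBJECTS, for EVERY package `C : SignedColemanKatoData W p f ϖ κ γ ε I` of part 2's fact and every
height-one prime `𝔭` of `Λ = ℤ_p⟦T⟧` (`signedSelmerDual_lengthAt_add_eq`):

  `length_𝔭 X^ε(E/ℚ_∞) + length_𝔭 (𝐇¹_Γ(T_pW) / C.Z) = length_𝔭 X₀(E/ℚ_∞) + length_𝔭 Λ/(G₁)`,

`G₁ = C(ϖ)·L` the Néron-normalised sign-`ε` Pollack function, in `ℕ∞` (no finiteness hypothesis), by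
pure `Λ`-bookkeeping (§1) from the three printed properties the package pins: `col = Col^ε ∘ loc_p`
INJECTIVE (Thm. 7.3 i)), (7.21) exact, the two-sided localized image clause `col(Z)_𝔭 = (G₁)_𝔭`
(Thm. 6.3 + Kato Thm. 12.6).  Parts 1/3/4 extracted only INEQUALITIES from the same data.

## Consequences recorded here (all kernel, class-wide; §2–§3)

* `signedSelmerDual_lengthAt_le_fine_add` — RIDER-FREE, ANY image: `μ(X^ε) ≤ μ(X₀) + μ(L_p^ε)` (and
  the same at every height-one prime): the `μ`-defect of the sign-`ε` main [C] is at most `μ` of the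
  FINE Selmer group (Kato's integral bound `μ(X^ε) ≤ μ(L_p^ε)` needs (12.5.2), false on item 4's
  domain: lane A's `smallImage_not_imageContainsSL2`).
* `signedSelmerDual_lengthAt_eq_iff_fine_lengthAt_eq` — Kobayashi's Thm. 7.4 made LOCAL: at each
  height-one `𝔭`, `length_𝔭 X^ε = length_𝔭 Λ/(L_p^ε)` iff `length_𝔭 X₀ = length_𝔭 (𝐇¹/Z)` (the pinned
  `𝐇¹ = I.H` and the package's `Z = C.Z` of p529649; NO (Ka)-type hypothesis — the delta vs
  Lei–Sujatha 2021 Thm. 1.2, which assumes (Ka)).  At `𝔭 = (p)`: the `μ`-part of the sign-`ε` main [C]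
  ⟺ `μ(X₀) = μ(𝐇¹/Z)`, the `μ`-part of Kato's Conj. 12.10 for that `Z`.
* §3, under parts 3/4's ONE-SIGN analytic rider at non-surjective image:
  `fine_lengthAt_eq_zero_of_hasUnitContent` (the rider ⟹ `length_(p) X₀ = 0`, i.e. (R-an) implies the
  algebraic rider of part 7) and `signedSelmerDual_lengthAt_add_eq_of_hasUnitContent_anySign` (part
  4's `μ(X^ε) ≤ μ(L_p^ε)` becomes `μ(X^ε) + μ(𝐇¹/Z) = μ(L_p^ε)`; part 4 untouched).
Part 7 (`…SmallImageSignedMuConjA.lean`) turns the first bullet into a closer of the registered stub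
`stub_saturationSmallImage` with Coates–Sujatha's Conjecture A in place of the analytic rider.

NOT here: no new named fact (debt 0); no claim on the crux; no per-pair record (lane A's); no claim
that `Z` is the same module for both signs (part 2's structure carries `Z` per sign); the Eisenstein
half is not touched.  Nearest print: Kato p. 280; Kobayashi Thm. 7.4; Lei–Sujatha 2021 Thm. 1.2.

References: [Kobayashi2003] Thm. 6.2–6.3 (p. 11), Prop. 7.1, Thm. 7.3 (7.21), Thm. 7.4 (pp. 12–13);
[Kato2004Asterisque] Thm. 12.6, Conj. 12.10, §13.8, §17.13 (p. 280); [LeiSujatha2021] Thm. 1.2;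
[GreenbergVatsal2000] §3; tree: parts 1–5 of this seat (p528404, p529649, p532179, p533653, p536189).
-/

set_option linter.dupNamespace false
set_option autoImplicit false

noncomputable section

open scoped Classical MatrixGroups ModularForm Polynomial

open CongruenceSubgroup WeierstrassCurve Field
  Literature.NumberTheory.EllipticCurves Literature.NumberTheory.EllipticCurves.ModularForms
  Literature.NumberTheory.EllipticCurves.Rank1Residual
  Literature.NumberTheory.EllipticCurves.Kobayashi2003 Literature.NumberTheory.EllipticCurves.Kato2004
  Literature.NumberTheory.EllipticCurves.GreenbergVatsal2000 ZpExtension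
  Literature.NumberTheory.EllipticCurves.IwasawaAlgebra Literature.NumberTheory.EllipticCurves.Module
  Summit.BirchSwinnertonDyer.Rank1Residual.Supersingular
  Summit.BirchSwinnertonDyer.BirchSwinnertonDyer.Rank1Residual
  Summit.BirchSwinnertonDyer.BirchSwinnertonDyer.Theorems.SmallImageSignedMuTransfer

namespace Summit.BirchSwinnertonDyer.BirchSwinnertonDyer.Theorems.SmallImageSignedMuDefect

/-! ### §1 Pure `Λ`-bookkeeping: the four-term length identity of an exact `H →ᶜ Λ →ʲ X →ᵏ Y → 0`,
`c` injective, `Z ≤ H` a submodule whose image agrees with `(G)` after localisation -/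

section Bookkeeping

variable {R : Type*} [CommRing R] {V : Type*} [AddCommGroup V] [Module R V]

/-- **Enlarging a submodule by an `s`-torsion amount keeps the local length of the quotient away
from `s`**: `s • N ⊆ M`, `s ∉ 𝔭` ⟹ `length_𝔭 (V/M) = length_𝔭 (V/(M + N))` (`(M + N)/M` is `s`-torsion). [folklore] -/
theorem lengthAt_quotient_eq_lengthAt_quotient_sup (M N : Submodule R V) {s : R}
    (𝔭 : PrimeSpectrum R) (hs : s ∉ 𝔭.asIdeal) (hNM : ∀ x ∈ N, s • x ∈ M) :
    lengthAt R (V ⧸ M) 𝔭 = lengthAt R (V ⧸ (M ⊔ N)) 𝔭 := by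
  rw [lengthAt_eq_add_quotient ((M ⊔ N).map M.mkQ) 𝔭,
    lengthAt_eq_of_linearEquiv (Submodule.quotientQuotientEquivQuotient M (M ⊔ N) le_sup_left) 𝔭]
  have htors : Module.IsTorsionBy R ((M ⊔ N).map M.mkQ) s := by
    rintro ⟨y, hy⟩
    obtain ⟨x, hx, rfl⟩ := hy
    obtain ⟨m, hm, n, hn, rfl⟩ := Submodule.mem_sup.mp hx
    refine Subtype.ext ?_
    change s • M.mkQ (m + n) = 0
    rw [← map_smul, smul_add, Submodule.mkQ_apply, Submodule.Quotient.mk_eq_zero]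
    exact M.add_mem (M.smul_mem s hm) (hNM n hn)
  rw [lengthAt_eq_zero_of_isTorsionBy htors 𝔭 hs, zero_add]

/-- **Submodules that agree after localisation at `𝔭` have quotients of equal local length at `𝔭`**:
`s • N ⊆ M`, `s • M ⊆ N`, `s ∉ 𝔭` ⟹ `length_𝔭 (V/M) = length_𝔭 (V/N)`. [folklore] -/
theorem lengthAt_quotient_eq_of_smul_mem (M N : Submodule R V) {s : R}
    (𝔭 : PrimeSpectrum R) (hs : s ∉ 𝔭.asIdeal) (hNM : ∀ x ∈ N, s • x ∈ M)
    (hMN : ∀ x ∈ M, s • x ∈ N) :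
    lengthAt R (V ⧸ M) 𝔭 = lengthAt R (V ⧸ N) 𝔭 := by
  rw [lengthAt_quotient_eq_lengthAt_quotient_sup M N 𝔭 hs hNM,
    lengthAt_quotient_eq_lengthAt_quotient_sup N M 𝔭 hs hMN, sup_comm]

variable {H X Y : Type*} [AddCommGroup H] [Module R H] [AddCommGroup X] [Module R X]
  [AddCommGroup Y] [Module R Y]

/-- **`length_𝔭 X = length_𝔭 (R / range c) + length_𝔭 Y`** along `H →ᶜ R →ʲ X →ᵏ Y → 0` exact at
`R`, at `X` and at `Y` (`k` onto): `j` factors through an injection `R / ker j = R / range c ↪ X` with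
cokernel `Y`. [folklore] -/
theorem lengthAt_eq_lengthAt_quotient_range_add (c : H →ₗ[R] R) (j : R →ₗ[R] X) (k : X →ₗ[R] Y)
    (hcj : Function.Exact c j) (hjk : Function.Exact j k) (hk : Function.Surjective k)
    (𝔭 : PrimeSpectrum R) :
    lengthAt R X 𝔭 = lengthAt R (R ⧸ LinearMap.range c) 𝔭 + lengthAt R Y 𝔭 := by
  have hker : LinearMap.ker j = LinearMap.range c := LinearMap.exact_iff.mp hcj
  let j' : (R ⧸ LinearMap.range c) →ₗ[R] X := (LinearMap.range c).liftQ j hker.ge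
  have hj'inj : Function.Injective j' := by
    rw [← LinearMap.ker_eq_bot]
    exact Submodule.ker_liftQ_eq_bot _ _ _ hker.le
  have hj'k : Function.Exact j' k := by
    rw [LinearMap.exact_iff, Submodule.range_liftQ]
    exact LinearMap.exact_iff.mp hjk
  exact lengthAt_eq_add_of_exact j' k hj'inj hk hj'k 𝔭

/-- **`length_𝔭 (R / c(Z)) = length_𝔭 (H / Z) + length_𝔭 (R / range c)`** for an INJECTIVE `c : H → R`
and a submodule `Z ≤ H`: the map `H → R / c(Z)` has kernel `Z` and cokernel `R / range c`. [folklore] -/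
theorem lengthAt_quotient_map_eq_add (c : H →ₗ[R] R) (hc : Function.Injective c)
    (Z : Submodule R H) (𝔭 : PrimeSpectrum R) :
    lengthAt R (R ⧸ Submodule.map c Z) 𝔭 =
      lengthAt R (H ⧸ Z) 𝔭 + lengthAt R (R ⧸ LinearMap.range c) 𝔭 := by
  set M : Submodule R R := Submodule.map c Z with hM
  let φ : H →ₗ[R] R ⧸ M := M.mkQ ∘ₗ c
  have hkerφ : LinearMap.ker φ = Z := by
    rw [LinearMap.ker_comp, Submodule.ker_mkQ, hM, Submodule.comap_map_eq_of_injective hc]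
  have hrangeφ : LinearMap.range φ = (LinearMap.range c).map M.mkQ := LinearMap.range_comp _ _
  have hMle : M ≤ LinearMap.range c := by
    rw [hM, LinearMap.range_eq_map]; exact Submodule.map_mono le_top
  rw [lengthAt_eq_add_quotient (LinearMap.range φ) 𝔭]
  congr 1
  · rw [← lengthAt_eq_of_linearEquiv φ.quotKerEquivRange 𝔭,
      lengthAt_eq_of_linearEquiv (Submodule.quotEquivOfEq _ _ hkerφ) 𝔭]
  · rw [lengthAt_eq_of_linearEquiv (Submodule.quotEquivOfEq _ _ hrangeφ) 𝔭,
      lengthAt_eq_of_linearEquiv (Submodule.quotientQuotientEquivQuotient M (LinearMap.range c) hMle) 𝔭]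

/-- **The four-term identity.**  Let `H →ᶜ R →ʲ X →ᵏ Y → 0` be exact at `R`, `X`, `Y` with `c`
INJECTIVE, `Z ≤ H` a submodule and `G ∈ R`; suppose the ideals `c(Z)` and `(G)` agree after
localisation at the prime `𝔭` (some `s ∉ 𝔭` has `s·G ∈ c(Z)` and `s·c(z) ∈ (G)` for all `z ∈ Z`).
Then `length_𝔭 X + length_𝔭 (H/Z) = length_𝔭 Y + length_𝔭 (R/(G))` (in `ℕ∞`; no finiteness
needed).  With `c = Col^ε ∘ loc_p` on `𝐇¹(T)`, `Z` Kato's zeta module, `X = X^ε(E/ℚ_∞)`,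
`Y = X₀(E/ℚ_∞)`, `G = L_p^ε(E)` this is Kato's §17.13 length identity (p. 280) in Kobayashi's signed
setting (proof of Thm. 7.4, p. 13), prime by prime.  Module theory only; nothing about any curve is
asserted here. [cite: Kato2004Asterisque, §17.13 (p. 280)] [cite: Kobayashi2003, proof of Thm. 7.4 (p. 13)] -/
theorem lengthAt_add_lengthAt_quotient_eq_of_exact (c : H →ₗ[R] R) (hc : Function.Injective c)
    (j : R →ₗ[R] X) (k : X →ₗ[R] Y) (hcj : Function.Exact c j) (hjk : Function.Exact j k)
    (hk : Function.Surjective k) (Z : Submodule R H) {G s : R} (𝔭 : PrimeSpectrum R)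
    (hs : s ∉ 𝔭.asIdeal) (hsG : s * G ∈ Submodule.map c Z)
    (hZG : ∀ z ∈ Z, s * c z ∈ Ideal.span {G}) :
    lengthAt R X 𝔭 + lengthAt R (H ⧸ Z) 𝔭 =
      lengthAt R Y 𝔭 + lengthAt R (R ⧸ Ideal.span {G}) 𝔭 := by
  have hMG : lengthAt R (R ⧸ Submodule.map c Z) 𝔭 = lengthAt R (R ⧸ Ideal.span {G}) 𝔭 := by
    refine lengthAt_quotient_eq_of_smul_mem (Submodule.map c Z) (Ideal.span {G}) 𝔭 hs ?_ ?_
    · intro x hx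
      obtain ⟨a, rfl⟩ := Ideal.mem_span_singleton'.mp hx
      rw [smul_eq_mul, ← mul_assoc, mul_comm s a, mul_assoc]
      exact Ideal.mul_mem_left _ a hsG
    · rintro _ ⟨z, hz, rfl⟩
      rw [smul_eq_mul]
      exact hZG z hz
  rw [lengthAt_eq_lengthAt_quotient_range_add c j k hcj hjk hk 𝔭, ← hMG,
    lengthAt_quotient_map_eq_add c hc Z 𝔭, add_comm (lengthAt R (R ⧸ LinearMap.range c) 𝔭) (lengthAt R Y 𝔭),
    add_assoc, add_comm (lengthAt R (R ⧸ LinearMap.range c) 𝔭)]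

end Bookkeeping

/-! ### §2 The identity on the pinned objects: every package of `thm62_63_73_signedColemanKato_zeta` -/

section Package

variable (W : WeierstrassCurve ℚ) [W.IsElliptic] (p : ℕ) [Fact p.Prime]

/-- **The signed `μ`/`λ`-defect identity, prime by prime (Kato §17.13 p. 280 ∕ Kobayashi Thm. 7.4's
proof on the pinned objects).**  For every package `C : SignedColemanKatoData W p f ϖ κ γ ε I`
(Kobayashi Thm. 6.2–6.3–7.3 with Kato Thm. 12.6, the fact `thm62_63_73_signedColemanKato_zeta`), with
`E[p]` irreducible, every sign-`ε` Pollack function `L` of `f` with Néron normalisation `G₁`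
(`ι G₁ = C(ϖ)·ι L`), every dual datum `D` of `Sel^ε(E/ℚ_∞)`, every dual datum `Y` of
`Sel₀(ℚ_∞, E[p^∞])` and every height-one prime `𝔭` of `Λ`:
`length_𝔭 X^ε + length_𝔭 (𝐇¹/Z) = length_𝔭 X₀ + length_𝔭 Λ/(G₁)`.
At `𝔭 = (p)`: `μ(X^ε) + μ(𝐇¹/Z) = μ(X₀) + μ(L_p^ε)`; off `(p)`: the `λ`-parts.  No image
hypothesis, no rider; CONDITIONAL only on the package (a transcription of print).
[cite: Kobayashi2003, Thm. 6.2 (6.13)–(6.14), Thm. 6.3 (p. 11), Thm. 7.3 i) (7.21) and proof of Thm. 7.4 (p. 13)]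
[cite: Kato2004Asterisque, Thm. 12.6 (p. 222) and §17.13 (p. 280)] -/
theorem signedSelmerDual_lengthAt_add_eq
    [ContinuousSMul ℤ_[p] (W.tateModule p)] [Module.Free ℤ_[p] (W.tateModule p)]
    [Module.Finite ℤ_[p] (W.tateModule p)]
    {N : ℕ} {f : CuspForm (Gamma0 N) 2} {ϖ : ℚ} {κ : ZpExtension ℚ p} {γ : absoluteGaloisGroup ℚ}
    {ε : ℤˣ} {I : IwasawaH1Data W p κ γ} (C : SignedColemanKatoData W p f ϖ κ γ ε I)
    (hirr : W.HasIrreducibleModPGaloisRep p) {L G₁ : IwasawaAlgebra p}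
    (hL : IsSignedPAdicLFunction f p ε L)
    (hG₁ : iwasawaToPowerSeries p G₁ = PowerSeries.C ((ϖ : ℚ) : ℚ_[p]) * iwasawaToPowerSeries p L)
    (D : SignedSelmerDualData W κ γ ε) (Y : W.FineSelmerDualData κ γ)
    (𝔭 : PrimeSpectrum (IwasawaAlgebra p)) (h𝔭 : 𝔭.asIdeal.height = 1) :
    lengthAt (IwasawaAlgebra p) D.X 𝔭 + lengthAt (IwasawaAlgebra p) (I.H ⧸ C.Z) 𝔭 =
      lengthAt (IwasawaAlgebra p) Y.X 𝔭 +
        lengthAt (IwasawaAlgebra p) (IwasawaAlgebra p ⧸ Ideal.span {G₁}) 𝔭 := by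
  obtain ⟨j, k, hcj, hjk, hk⟩ := C.exact D Y
  obtain ⟨s, hs, hsG, hZG⟩ := C.image_zeta_localized hirr L G₁ hL hG₁ 𝔭 h𝔭
  exact lengthAt_add_lengthAt_quotient_eq_of_exact C.col C.col_injective j k hcj hjk hk C.Z 𝔭 hs hsG
    hZG

/-- **Rider-free bound: the `μ`-defect of the sign-`ε` main [C] is at most `μ` of the FINE Selmer
group.**  Same setting: `length_𝔭 X^ε ≤ length_𝔭 X₀ + length_𝔭 Λ/(G₁)` at every height-one `𝔭`
(drop the `𝐇¹/Z` term of the identity).  At `𝔭 = (p)`: `μ(X^ε) ≤ μ(X₀) + μ(L_p^ε)` — at ANY image of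
`ρ̄_{E,p}`; Kato's INTEGRAL divisibility would give `μ(X^ε) ≤ μ(L_p^ε)` but needs (12.5.2).
[cite: Kobayashi2003, Thm. 7.3 i) (7.21) and proof of Thm. 7.4 (p. 13)] [cite: Kato2004Asterisque, §17.13 (p. 280)] -/
theorem signedSelmerDual_lengthAt_le_fine_add
    [ContinuousSMul ℤ_[p] (W.tateModule p)] [Module.Free ℤ_[p] (W.tateModule p)]
    [Module.Finite ℤ_[p] (W.tateModule p)]
    {N : ℕ} {f : CuspForm (Gamma0 N) 2} {ϖ : ℚ} {κ : ZpExtension ℚ p} {γ : absoluteGaloisGroup ℚ}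
    {ε : ℤˣ} {I : IwasawaH1Data W p κ γ} (C : SignedColemanKatoData W p f ϖ κ γ ε I)
    (hirr : W.HasIrreducibleModPGaloisRep p) {L G₁ : IwasawaAlgebra p}
    (hL : IsSignedPAdicLFunction f p ε L)
    (hG₁ : iwasawaToPowerSeries p G₁ = PowerSeries.C ((ϖ : ℚ) : ℚ_[p]) * iwasawaToPowerSeries p L)
    (D : SignedSelmerDualData W κ γ ε) (Y : W.FineSelmerDualData κ γ)
    (𝔭 : PrimeSpectrum (IwasawaAlgebra p)) (h𝔭 : 𝔭.asIdeal.height = 1) :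
    lengthAt (IwasawaAlgebra p) D.X 𝔭 ≤
      lengthAt (IwasawaAlgebra p) Y.X 𝔭 +
        lengthAt (IwasawaAlgebra p) (IwasawaAlgebra p ⧸ Ideal.span {G₁}) 𝔭 := by
  rw [← signedSelmerDual_lengthAt_add_eq W p C hirr hL hG₁ D Y 𝔭 h𝔭]
  exact le_self_add

/-- **Kobayashi's Thm. 7.4 made local: the sign-`ε` main [C] and Kato's main [C] (12.10) have the
SAME defect at every height-one prime.**  Same setting, with `length_𝔭 X^ε` finite (e.g. `X^ε`
finitely generated torsion, Thm. 1.2): `length_𝔭 X^ε = length_𝔭 Λ/(G₁)` iff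
`length_𝔭 X₀ = length_𝔭 (𝐇¹/Z)`.  At `𝔭 = (p)`: the `μ`-part of `Char X^ε = (L_p^ε)` holds iff
`μ(X₀(E/ℚ_∞)) = μ(𝐇¹(T)/Z(T))` — a sign-free statement.
[cite: Kobayashi2003, Thm. 7.4 and its proof (p. 13)] [cite: Kato2004Asterisque, Conj. 12.10 (p. 224) and §17.13 (p. 280)] -/
theorem signedSelmerDual_lengthAt_eq_iff_fine_lengthAt_eq
    [ContinuousSMul ℤ_[p] (W.tateModule p)] [Module.Free ℤ_[p] (W.tateModule p)]
    [Module.Finite ℤ_[p] (W.tateModule p)]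
    {N : ℕ} {f : CuspForm (Gamma0 N) 2} {ϖ : ℚ} {κ : ZpExtension ℚ p} {γ : absoluteGaloisGroup ℚ}
    {ε : ℤˣ} {I : IwasawaH1Data W p κ γ} (C : SignedColemanKatoData W p f ϖ κ γ ε I)
    (hirr : W.HasIrreducibleModPGaloisRep p) {L G₁ : IwasawaAlgebra p}
    (hL : IsSignedPAdicLFunction f p ε L)
    (hG₁ : iwasawaToPowerSeries p G₁ = PowerSeries.C ((ϖ : ℚ) : ℚ_[p]) * iwasawaToPowerSeries p L)
    (D : SignedSelmerDualData W κ γ ε) (Y : W.FineSelmerDualData κ γ)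
    (𝔭 : PrimeSpectrum (IwasawaAlgebra p)) (h𝔭 : 𝔭.asIdeal.height = 1)
    (hfin : lengthAt (IwasawaAlgebra p) D.X 𝔭 ≠ ⊤) :
    lengthAt (IwasawaAlgebra p) D.X 𝔭 =
        lengthAt (IwasawaAlgebra p) (IwasawaAlgebra p ⧸ Ideal.span {G₁}) 𝔭 ↔
      lengthAt (IwasawaAlgebra p) Y.X 𝔭 = lengthAt (IwasawaAlgebra p) (I.H ⧸ C.Z) 𝔭 := by
  have hid := signedSelmerDual_lengthAt_add_eq W p C hirr hL hG₁ D Y 𝔭 h𝔭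
  obtain ⟨j, k, -, hjk, hk⟩ := C.exact D Y
  have hYle : lengthAt (IwasawaAlgebra p) Y.X 𝔭 ≤ lengthAt (IwasawaAlgebra p) D.X 𝔭 :=
    lengthAt_le_of_surjective k hk 𝔭
  have hYfin : lengthAt (IwasawaAlgebra p) Y.X 𝔭 ≠ ⊤ := ne_top_of_le_ne_top hfin hYle
  set a := lengthAt (IwasawaAlgebra p) D.X 𝔭
  set b := lengthAt (IwasawaAlgebra p) (I.H ⧸ C.Z) 𝔭
  set c := lengthAt (IwasawaAlgebra p) Y.X 𝔭
  set d := lengthAt (IwasawaAlgebra p) (IwasawaAlgebra p ⧸ Ideal.span {G₁}) 𝔭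
  constructor
  · intro had
    -- `d + b = d + c` with `d = a` finite ⟹ `b = c`
    have hdfin : d ≠ ⊤ := had ▸ hfin
    rw [had, add_comm c d] at hid
    exact (ENat.add_right_injective_of_ne_top hdfin hid).symm
  · intro hcb
    -- `a + b = d + b` with `b = c` finite ⟹ `a = d`
    have hbfin : b ≠ ⊤ := hcb ▸ hYfin
    rw [hcb, add_comm b d] at hid
    exact ENat.add_left_injective_of_ne_top hbfin hid

end Package

/-! ### §3 Under parts 3/4's one-sign rider: `μ(X₀) = 0` (Conjecture A's `length` form) and the
EXACT `μ`-formula (part 4's inequality with the slack identified as `μ(𝐇¹/Z)`) -/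

section OneSignExact

variable (W : WeierstrassCurve ℚ) [W.IsElliptic] [W.IsGloballyMinimal] (p : ℕ) [Fact p.Prime]

/-- **The one-sign analytic rider implies Conjecture A's `length` form: `length_(p) X₀(E/ℚ_∞) = 0`.**
Odd good `p`, `a_p = 0`, `ρ̄_{E,p}` NOT onto, newform `f` with period ratio `ϖ`; if for SOME sign `ε₀`
the Pollack function `L₀` has a unit coefficient, then EVERY dual fine Selmer datum `Y` over the
cyclotomic `(κ, γ)` has `length_(p) X₀ = 0`.  This is the chain of parts 1–3 isolated as a theorem
(it was inlined in part 4's §1): the `ε₀`-package's localized image clause and `L₀ ∉ (p)` give a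
genuine Euler-system class outside `p𝐇¹` (`exists_mem_set_not_mem_pSmul`), and the reduction-free
core (`fineSelmerDual_lengthAt_augIdealP_eq_zero_of_eulerSystemClass`, part 1 ∘
`CoreAssembly.coreOdd_anyReduction_holds`) concludes.  Hence on item 4's domain the analytic rider
(R-an) of parts 3/4 IMPLIES the algebraic rider «`length_(p) X₀ = 0`» used by part 7.
[cite: Kato2004Asterisque, Thm. 12.6 (p. 222), §13.8 (pp. 228–229)] [cite: Kobayashi2003, Thm. 6.3 (p. 11)] -/
theorem fine_lengthAt_eq_zero_of_hasUnitContent (hCK : thm62_63_73_signedColemanKato_zeta)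
    (h5 : realPeriodRat_eq_unit_mul_plusPeriod) (h3 : realPeriodRat_eq_unit_mul_plusPeriod_three)
    (hp : p ≠ 2) (hgood : W.HasGoodReductionAtPrime p) (hap : W.frobeniusTrace p = 0)
    (hns : ¬ W.HasSurjectiveModNGaloisRep p)
    {N : ℕ} [NeZero N] {f : CuspForm (Gamma0 N) 2} (hf : IsNewformOf W f)
    {ϖ : ℚ} (hϖ : (ϖ : ℝ) * W.realPeriodRat = plusPeriod f)
    {ε₀ : ℤˣ} {L₀ : IwasawaAlgebra p} (hL₀ : IsSignedPAdicLFunction f p ε₀ L₀)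
    (hu₀ : HasUnitContent L₀)
    {κ : ZpExtension ℚ p} {γ : absoluteGaloisGroup ℚ} (hκ : κ.IsCyclotomic) (hγ : κ.IsTopGenerator γ)
    (hγ' : IsCyclotomicVariable p γ) (Y : W.FineSelmerDualData κ γ)
    (𝔭 : PrimeSpectrum (IwasawaAlgebra p)) (h𝔭 : 𝔭.asIdeal = augIdealP p) :
    lengthAt (IwasawaAlgebra p) Y.X 𝔭 = 0 := by
  haveI : ContinuousSMul ℤ_[p] (W.tateModule p) := TateModule.continuousSMul_padicInt
  haveI : Module.Free ℤ_[p] (W.tateModule p) := W.module_free_tateModule_holds p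
  haveI : Module.Finite ℤ_[p] (W.tateModule p) := W.module_finite_tateModule_holds p
  have hirr : W.HasIrreducibleModPGaloisRep p :=
    hasIrreducibleModPGaloisRep_of_dvd_frobeniusTrace W p hp
      (W.not_dvd_minimalDiscriminantInt_of_hasGoodReductionAtPrime' p hgood) (by rw [hap]; exact dvd_zero _)
  obtain ⟨I⟩ := nonempty_iwasawaH1Data_holds W p κ γ hκ hγ
  obtain ⟨K₀⟩ := hCK W p f ϖ κ γ hp hgood hap hf hϖ hκ hγ hγ' ε₀ I
  have hvϖ : padicValRat p ϖ = 0 :=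
    Rank1Residual.padicValRat_periodRatio_eq_zero h5 h3 W p hp hgood hirr f hf ϖ hϖ
  have hϖ0 : ϖ ≠ 0 := by
    intro hz
    rw [hz, Rat.cast_zero, zero_mul] at hϖ
    exact (IsNewform0.plusPeriod_pos_holds hf.1 hf.coeffField_eq_bot).ne' hϖ.symm
  obtain ⟨u, hu'⟩ := exists_units_coe_eq_ratCast hϖ0 hvϖ
  obtain ⟨-, hι₀⟩ := span_C_units_mul_eq u L₀
  set G₀ : IwasawaAlgebra p := PowerSeries.C (u : ℤ_[p]) * L₀ with hG₀def
  have hG₀ : iwasawaToPowerSeries p G₀ =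
      PowerSeries.C ((ϖ : ℚ) : ℚ_[p]) * iwasawaToPowerSeries p L₀ := by rw [hι₀, hu']
  have hL₀p : L₀ ∉ augIdealP p := KatoMuSkeleton.not_mem_augIdealP_of_hasUnitContent hu₀
  have hG₀p : G₀ ∉ augIdealP p := by
    intro h
    apply hL₀p
    have h' := Ideal.mul_mem_left (augIdealP p) (PowerSeries.C ((u⁻¹ : ℤ_[p]ˣ) : ℤ_[p])) h
    rwa [hG₀def, ← mul_assoc, ← map_mul, Units.inv_mul, map_one, one_mul] at h'
  have h𝔭1 : 𝔭.asIdeal.height = 1 := by rw [h𝔭]; exact height_augIdealP_holds p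
  obtain ⟨s₀, hs₀, hs₀G, -⟩ := K₀.image_zeta_localized hirr L₀ G₀ hL₀ hG₀ 𝔭 h𝔭1
  have hs₀' : s₀ ∉ augIdealP p := h𝔭 ▸ hs₀
  obtain ⟨z, hzES, hzp⟩ := exists_mem_set_not_mem_pSmul K₀.col K₀.Z K₀.zeta_le_span hs₀' hG₀p hs₀G
  exact (fineSelmerDual_lengthAt_augIdealP_eq_zero_of_eulerSystemClass W p κ γ I hp hirr hns hκ hγ
    ⟨z, hzES, hzp⟩ Y 𝔭 h𝔭).2

/-- **`μ(X^ε) + μ(𝐇¹/Z) = μ(L_p^ε)` EXACTLY, for every sign, from ONE sign's unit coefficient at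
non-surjective image.**  Part 4 (`signed_lengthAt_le_of_hasUnitContent_anySign`, p533653) proved
`length_(p) X^ε ≤ length_(p) Λ/(L)`; the identity of §2 names the slack: it is `length_(p) (𝐇¹/Z)`
for the sign-`ε` package's zeta module `Z` (Kato Thm. 12.6), since the rider gives
`length_(p) X₀ = 0` (previous theorem).  So under (R-an) the `μ`-part of the sign-`ε` main [C] holds
iff `μ(𝐇¹/Z) = 0`.  Part 4 is untouched (this is a new theorem).  CONDITIONAL on the displayed
binders; NO partner.  [cite: Kobayashi2003, Thm. 6.3 (p. 11), Thm. 7.3 i) (7.21) and proof of Thm. 7.4 (p. 13)]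
[cite: Kato2004Asterisque, Thm. 12.6 (p. 222), §13.8 (pp. 228–229) and §17.13 (p. 280)] -/
theorem signedSelmerDual_lengthAt_add_eq_of_hasUnitContent_anySign
    (hCK : thm62_63_73_signedColemanKato_zeta)
    (h5 : realPeriodRat_eq_unit_mul_plusPeriod) (h3 : realPeriodRat_eq_unit_mul_plusPeriod_three)
    (hp : p ≠ 2) (hgood : W.HasGoodReductionAtPrime p) (hap : W.frobeniusTrace p = 0)
    (hns : ¬ W.HasSurjectiveModNGaloisRep p)
    {N : ℕ} [NeZero N] {f : CuspForm (Gamma0 N) 2} (hf : IsNewformOf W f)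
    {ϖ : ℚ} (hϖ : (ϖ : ℝ) * W.realPeriodRat = plusPeriod f)
    {ε₀ : ℤˣ} {L₀ : IwasawaAlgebra p} (hL₀ : IsSignedPAdicLFunction f p ε₀ L₀)
    (hu₀ : HasUnitContent L₀)
    {ε : ℤˣ} {L : IwasawaAlgebra p} (hL : IsSignedPAdicLFunction f p ε L)
    {κ : ZpExtension ℚ p} {γ : absoluteGaloisGroup ℚ} (hκ : κ.IsCyclotomic) (hγ : κ.IsTopGenerator γ)
    (hγ' : IsCyclotomicVariable p γ)
    [ContinuousSMul ℤ_[p] (W.tateModule p)] [Module.Free ℤ_[p] (W.tateModule p)]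
    [Module.Finite ℤ_[p] (W.tateModule p)]
    {I : IwasawaH1Data W p κ γ} (C : SignedColemanKatoData W p f ϖ κ γ ε I)
    (D : SignedSelmerDualData W κ γ ε) (Y : W.FineSelmerDualData κ γ)
    (𝔭 : PrimeSpectrum (IwasawaAlgebra p)) (h𝔭 : 𝔭.asIdeal = augIdealP p) :
    lengthAt (IwasawaAlgebra p) D.X 𝔭 + lengthAt (IwasawaAlgebra p) (I.H ⧸ C.Z) 𝔭 =
      lengthAt (IwasawaAlgebra p) (IwasawaAlgebra p ⧸ Ideal.span {L}) 𝔭 := by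
  have hirr : W.HasIrreducibleModPGaloisRep p :=
    hasIrreducibleModPGaloisRep_of_dvd_frobeniusTrace W p hp
      (W.not_dvd_minimalDiscriminantInt_of_hasGoodReductionAtPrime' p hgood) (by rw [hap]; exact dvd_zero _)
  -- the period unit: `G₁ := C(u)·L` is Néron-normalised and `(G₁) = (L)`
  have hvϖ : padicValRat p ϖ = 0 :=
    Rank1Residual.padicValRat_periodRatio_eq_zero h5 h3 W p hp hgood hirr f hf ϖ hϖ
  have hϖ0 : ϖ ≠ 0 := by
    intro hz
    rw [hz, Rat.cast_zero, zero_mul] at hϖ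
    exact (IsNewform0.plusPeriod_pos_holds hf.1 hf.coeffField_eq_bot).ne' hϖ.symm
  obtain ⟨u, hu'⟩ := exists_units_coe_eq_ratCast hϖ0 hvϖ
  obtain ⟨hspan₁, hι₁⟩ := span_C_units_mul_eq u L
  have hG₁ : iwasawaToPowerSeries p (PowerSeries.C (u : ℤ_[p]) * L) =
      PowerSeries.C ((ϖ : ℚ) : ℚ_[p]) * iwasawaToPowerSeries p L := by rw [hι₁, hu']
  have h𝔭1 : 𝔭.asIdeal.height = 1 := by rw [h𝔭]; exact height_augIdealP_holds p
  have hY0 : lengthAt (IwasawaAlgebra p) Y.X 𝔭 = 0 :=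
    fine_lengthAt_eq_zero_of_hasUnitContent W p hCK h5 h3 hp hgood hap hns hf hϖ hL₀ hu₀ hκ hγ hγ' Y
      𝔭 h𝔭
  have hid := signedSelmerDual_lengthAt_add_eq W p C hirr hL hG₁ D Y 𝔭 h𝔭1
  rwa [hY0, zero_add, hspan₁] at hid

end OneSignExact

end Summit.BirchSwinnertonDyer.BirchSwinnertonDyer.Theorems.SmallImageSignedMuDefect

end
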